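import Summits.NavierStokesRegularity.NavierStokesRegularity.Theorems.TypeIQuarterGateQuarterLawTypeICountReduction
import Summits.NavierStokesRegularity.NavierStokesRegularity.Theorems.TypeIQuarterGateQuarterLawTypeIOneScaleSmallness
import HarnessLib

/-!
# `TypeIQuarterGate.QuarterLawTypeI` (crux stmt-NavierStokesRegularity-23726), line `lorentz-upgrade`
# (registered skeleton sha16 a3194bad1babbefe): the stub `stub_countQuarterLaw` CLOSED BY NAME

`--supports stmt-NavierStokesRegularity-23726` (stub credit). The registered stub

  `stub_countQuarterLaw` (= route item `CountQuarterLaw`, stmt-23971): COUNT ⇒ QUARTER LAW under Type-I —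
  a maximal classical Leray–Hopf solution from a rapidly decaying datum with the sup-norm Type-I rate at
  `T` and the scale-uniform ε-concentration count has `∫ ‖curl u(t)‖² ≤ K/√(T−t)` on `[0,T)` —

is the composition of the three landed bricks of this seat:
* `CountQuarterLaw.quarterLaw_of_sparseCores` (sparse-core engine: global enstrophy identity, KNSS
  gradient rate, Lamb-form slice estimate split along abstract cores, Gronwall at the exponent `1/4`);
* `CountQuarterLaw.stub_countQuarterLaw_of_oneScale` (cores = doubled balls of a maximal separated
  concentrating family at ONE scale `λ√(T−t)`; COUNT bounds their number);
* `CountQuarterLaw.oneScaleSmallness` (one-scale ε-regularity smallness at vertex-`T` cylinders under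
  the Type-I scaled bounds: Seregin 2014 Prop. 3.11 (i) + the dissipation quantum, un-zoomed).

After this file the skeleton's composition `QuarterLawTypeI_of = stub_countQuarterLaw ∘ stub_lorentzCount
∘ stub_lorentzUpgrade` is closed modulo the two OPEN stubs `stub_lorentzUpgrade` (= `LorentzUpgradeTypeI`,
stmt-24108: time-Type-I ⇒ Lorentz-Type-I, an open problem) and `stub_lorentzCount` (= `LorentzCountTypeI`,
stmt-24109). HONEST LABEL: the quarter law is derived from a HYPOTHETICAL concentration count along a
HYPOTHETICAL Type-I blow-up; `QuarterLawTypeI` (23726), `UniformConcentrationCountTypeI` (23970) and NS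
regularity remain OPEN; nothing here bears on the summit.
-/

noncomputable section

-- the summit and its single sub-problem share the name (CONVENTIONS §1)
set_option linter.dupNamespace false

open Set Filter MeasureTheory Metric

namespace Summit.NavierStokesRegularity.NavierStokesRegularity.Theorems.CountQuarterLaw

open Literature.Analysis.FluidPDE

/-- **Registered stub `stub_countQuarterLaw` of the line `lorentz-upgrade` (crux `QuarterLawTypeI`,
stmt-23726), signature VERBATIM: COUNT ⇒ the quarter law under the sup-norm Type-I rate.** Composition of
the reduction `stub_countQuarterLaw_of_oneScale` with the one-scale smallness `oneScaleSmallness`.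
[cite: KochNadirashviliSereginSverak2009, §4 Prop. 4.1 (4.6)] [cite: Seregin2014, Ch. 6 §6.3 Prop. 3.11 (i)]
[cite: CaffarelliKohnNirenberg1982, Proposition 1] -/
theorem stub_countQuarterLaw :
    ∀ (ν T : ℝ), 0 < ν → 0 < T → ∀ (u : ℝ → EuclideanSpace ℝ (Fin 3) → EuclideanSpace ℝ (Fin 3))
      (p : ℝ → EuclideanSpace ℝ (Fin 3) → ℝ),
      Literature.Analysis.FluidPDE.IsMaximalSmoothSolution ν 0 u p T →
      Literature.Analysis.FluidPDE.IsLerayHopfOn T ν 0 (u 0) u →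
      Literature.Analysis.FluidPDE.HasRapidSpatialDecay (u 0) →
      Literature.Analysis.FluidPDE.IsTypeIBlowup u T →
      (∀ η : ℝ, 0 < η → ∃ N : ℕ, ∃ r₀ : ℝ, 0 < r₀ ∧ ∀ r : ℝ, 0 < r → r ≤ r₀ →
        ∀ σ : Finset (EuclideanSpace ℝ (Fin 3)),
          (∀ x ∈ σ, ∀ x' ∈ σ, x ≠ x' → 2 * r ≤ ‖x - x'‖) →
          (∀ x ∈ σ, ENNReal.ofReal (η * r) ≤ ∫⁻ s in Set.Ioo (T - r ^ 2) T,
            ∫⁻ y in Metric.ball x r,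
              ENNReal.ofReal (Literature.Analysis.FluidPDE.frobeniusNormSq (fderiv ℝ (u s) y))) →
          σ.card ≤ N) →
      ∃ K : ℝ, ∀ t ∈ Set.Ico 0 T,
        ∫⁻ x, ‖Literature.Analysis.FluidPDE.curl (u t) x‖ₑ ^ 2 ≤
          ENNReal.ofReal (K / Real.sqrt (T - t)) :=
  stub_countQuarterLaw_of_oneScale
    fun _ν _T hν hT _u _p hsol hLH _hdec hI => oneScaleSmallness hν hT hsol hLH hI

end Summit.NavierStokesRegularity.NavierStokesRegularity.Theorems.CountQuarterLaw

end
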